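import Literature.Probability.Percolation.HutchcroftGhostExploration
import Literature.Probability.ODonnellSaksSchrammServedio2005.BiasedCubeSum
import HarnessLib

/-!
# Hutchcroft's volume covariance inequality (Prop 3.1) for Bernoulli percolation on a finite graph

Source: T. Hutchcroft, Probab. Math. Phys. 1 (2020) 147–165, arXiv:1901.10363, §3, Proposition 3.1 (case
of a product measure): for a countable graph, `μ` Bernoulli bond percolation, `v` a vertex, `n ≥ 1`,
`λ > 0`,
  `∑_e Cov_μ[1(|K_v| ≥ n), ω(e)] ≥ [((1−e^{−λ}) − μ[1−e^{−λ|K_v|/n}]) / (2 sup_u μ[1−e^{−λ|K_u|/n}])] μ(|K_v| ≥ n)`.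
Here: the FINITE-graph, product-measure case, with the ghost density `h ∈ [0,1]` a free parameter in
place of `1 − e^{−λ/n}` (so `1 − e^{−λ}` becomes `1 − (1−h)^n` and `μ[1 − e^{−λ|K|/n}]` becomes
`E[1 − (1−h)^{|K|}]`), written multiplicatively and with `Cov[f, ω_e] = p_e(1−p_e) P(e pivotal)`:

  `((1 − (1−h)^n) − Φ_v) · P(|K_v| ≥ n) ≤ 2 M · ∑_e p_e (1−p_e) · P(e pivotal for {|K_v| ≥ n})`
  whenever `Φ_a := E[1 − (1−h)^{|K_a|}] ≤ M` for all `a`                (`volume_covariance_inequality`).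

The graph is a finite vertex type `W` with edge labels `E` and a symmetric incidence
`edge : W → W → Option E` whose labels have unique endpoints (as for a simple graph); probabilities are
finite weighted sums over `E → Bool` (`BiasedCube.lean`).  Proof = the source's: two-function OSSS for
the ghost-exploration strategy (`HutchcroftGhostExploration.lean`, `StrategyTree.lean`) with `f = 1(|K_v| ≥ n)`
and `g = 1(K_v ∋ green)`, revealment `δ_e ≤ 2M`, influences of `f` = pivotal probabilities (ghost
coordinates have influence `0` on `f`), and the ghost field integrated out exactly
(`P(K ∋ green | ω) = 1 − (1−h)^{|K|}`, `BiasedCubeSum.lean`).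
-/

namespace Literature.Probability.Percolation

open Finset Function Literature.Probability.ODonnellSaksSchrammServedio2005
open Literature.Probability.ODonnellSaksSchrammServedio2005.Strategy

namespace GhostExploration

variable {W E : Type*} {edge : W → W → Option E}

/-- Opening edges enlarges clusters. [cite: Hutchcroft2020, §3 proof of Prop 3.1 (f is increasing)] -/
theorem yReach_mono {y y' : E → Bool} (hle : ∀ e, y e = true → y' e = true) {a b : W}
    (hr : YReach edge y a b) : YReach edge y' a b := by
  unfold YReach at hr ⊢
  refine Relation.ReflTransGen.mono (fun c d hcd => ?_) _ _ hr
  obtain ⟨hne, e, he, hy⟩ := hcd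
  exact ⟨hne, e, he, hle e hy⟩

/-- For a symmetric incidence, open connection is symmetric.
[cite: Hutchcroft2020, §3 proof of Prop 3.1 (clusters of an undirected graph)] -/
theorem yReach_symm (hsymm : ∀ a b, edge a b = edge b a) {y : E → Bool} {a b : W}
    (h : YReach edge y a b) : YReach edge y b a := by
  unfold YReach at h ⊢
  induction h with
  | refl => exact Relation.ReflTransGen.refl
  | tail _ hcd ih =>
    obtain ⟨hne, e, he, hy⟩ := hcd
    exact Relation.ReflTransGen.head ⟨hne.symm, e, by rw [hsymm]; exact he, hy⟩ ih

/-- Updating an edge coordinate of the joint configuration updates the edge configuration.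
[cite: Hutchcroft2020, §3 proof of Prop 3.1 (Cov_P[f, ω(e)] = Cov_μ[f, ω(e)])] -/
private theorem inl_update [DecidableEq W] [DecidableEq E] (x : E ⊕ W → Bool) (e : E) (b : Bool) :
    (fun e' => update x (Sum.inl e) b (Sum.inl e')) = update (fun e' => x (Sum.inl e')) e b := by
  ext e'
  by_cases h : e' = e
  · subst h; simp
  · rw [update_of_ne h, update_of_ne (fun h' => h (Sum.inl_injective h'))]

variable (edge) in
open Classical in
/-- The indicator `g = 1(K_a ∋ green)` on the full cube. [cite: Hutchcroft2020, §3 proof of Prop 3.1 (the function g)] -/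
noncomputable def gind (a : W) (x : E ⊕ W → Bool) : ℝ := if HasGreen edge x a then 1 else 0

/-- `gpm = 2g − 1`. [cite: Hutchcroft2020, §3 proof of Prop 3.1 (the function g)] -/
theorem gpm_eq (a : W) (x : E ⊕ W → Bool) : gpm edge a x = 2 * gind edge a x - 1 := by
  unfold gpm gind; split_ifs <;> norm_num

variable [Fintype W] [Fintype E] [DecidableEq W] [DecidableEq E]

variable (edge) in
open Classical in
/-- The open cluster `K_a(y)` of `a` in the edge configuration `y`, as a finite set.
[cite: Hutchcroft2020, §3 proof of Prop 3.1 (the cluster K_v(ω))] -/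
noncomputable def cl (y : E → Bool) (a : W) : Finset W := univ.filter fun b => YReach edge y a b

variable (edge) in
open Classical in
/-- The volume indicator `f = 1(|K_v| ≥ n)` on edge configurations.
[cite: Hutchcroft2020, §3 proof of Prop 3.1 (the function f)] -/
noncomputable def fvol (n : ℕ) (v : W) (y : E → Bool) : ℝ := if n ≤ (cl edge y v).card then 1 else 0

variable (edge) in
/-- `Φ_a = E[1 − (1−h)^{|K_a|}]` = the probability that the cluster of `a` contains a green vertex.
[cite: Hutchcroft2020, §3 proof of Prop 3.1 (μ[1 − e^{−λ|K_u|/n}] = P(η(K_u) ≥ 1))] -/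
noncomputable def greenProb (pE : E → ℝ) (h : ℝ) (a : W) : ℝ :=
  ∑ y, wt pE y * (1 - (1 - h) ^ (cl edge y a).card)

variable (edge) in
/-- `P(e pivotal for {|K_v| ≥ n}) = E[f(ω^{e→1}) − f(ω^{e→0})]`.
[cite: Hutchcroft2020, §3 Prop 3.1 (Cov_μ[1(|K_v| ≥ n), ω(e)])] -/
noncomputable def pivVol (pE : E → ℝ) (n : ℕ) (v : W) (e : E) : ℝ :=
  ∑ y, wt pE y * (fvol edge n v (update y e true) - fvol edge n v (update y e false))

omit [Fintype E] [DecidableEq W] in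
/-- `f` is increasing in each edge: `f(y^{e→0}) ≤ f(y^{e→1})`.
[cite: Hutchcroft2020, §3 proof of Prop 3.1 (f is increasing)] -/
theorem fvol_update_false_le (n : ℕ) (v : W) (y : E → Bool) (e : E) :
    fvol edge n v (update y e false) ≤ fvol edge n v (update y e true) := by
  classical
  have hsub : cl edge (update y e false) v ⊆ cl edge (update y e true) v := by
    intro b hb
    simp only [cl, Finset.mem_filter, Finset.mem_univ, true_and] at hb ⊢
    refine yReach_mono (fun e' he' => ?_) hb
    by_cases hee : e' = e
    · subst hee; simp at he'
    · rwa [update_of_ne hee] at he' ⊢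
  have hcard := Finset.card_le_card hsub
  unfold fvol
  by_cases hf : n ≤ (cl edge (update y e false) v).card
  · rw [if_pos hf, if_pos (hf.trans hcard)]
  · rw [if_neg hf]; split_ifs <;> norm_num

omit [Fintype E] [DecidableEq W] [DecidableEq E] in
/-- `f ∈ {0,1}`: nonnegativity. [cite: Hutchcroft2020, §3 proof of Prop 3.1 (f is {0,1}-valued)] -/
theorem fvol_nonneg (n : ℕ) (v : W) (y : E → Bool) : 0 ≤ fvol edge n v y := by
  unfold fvol; split_ifs <;> norm_num

omit [Fintype E] [DecidableEq W] [DecidableEq E] in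
/-- `K_a ∋ green` iff some vertex of the finite cluster `cl y a` carries a green ghost bit.
[cite: Hutchcroft2020, §3 proof of Prop 3.1 (g = 1(η(u) = 1 for some u ∈ K_v))] -/
theorem hasGreen_iff (hsymm : ∀ a b, edge a b = edge b a) (x : E ⊕ W → Bool) (a : W) :
    HasGreen edge x a ↔ ∃ u ∈ cl edge (fun e => x (Sum.inl e)) a, x (Sum.inr u) = true := by
  classical
  constructor
  · rintro ⟨u, hu, hr⟩
    exact ⟨u, by simp only [cl, Finset.mem_filter, Finset.mem_univ, true_and]; exact yReach_symm hsymm hr, hu⟩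
  · rintro ⟨u, hu, hx⟩
    simp only [cl, Finset.mem_filter, Finset.mem_univ, true_and] at hu
    exact ⟨u, hx, yReach_symm hsymm hu⟩

omit [Fintype E] [DecidableEq E] in
open Classical in
/-- GHOST INTEGRATION: conditionally on the edges, `P(K_a ∋ green) = 1 − (1−h)^{|K_a|}`.
[cite: Hutchcroft2020, §3 proof of Prop 3.1 (P(η(K_u) ≥ 1) = μ[1 − e^{−λ|K_u|/n}])] -/
theorem sum_ghost_hasGreen (hsymm : ∀ a b, edge a b = edge b a) (h : ℝ) (y : E → Bool) (a : W) :
    ∑ z : W → Bool, wt (fun _ => h) z * (if HasGreen edge (Sum.elim y z) a then (1 : ℝ) else 0)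
      = 1 - (1 - h) ^ (cl edge y a).card := by
  have key := sum_wt_exists_true (fun _ : W => h) (cl edge y a)
  rw [Finset.prod_const] at key
  rw [← key]
  refine Finset.sum_congr rfl fun z _ => ?_
  have hiff : HasGreen edge (Sum.elim y z) a ↔ ∃ u ∈ cl edge y a, z u = true := by
    rw [hasGreen_iff hsymm]
    exact Iff.rfl
  by_cases hg : HasGreen edge (Sum.elim y z) a
  · rw [if_pos hg, if_pos (hiff.mp hg)]
  · rw [if_neg hg, if_neg (fun h' => hg (hiff.mpr h'))]

/-- `E[g_a] = Φ_a` (ghost field integrated out).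
[cite: Hutchcroft2020, §3 proof of Prop 3.1 (P(η(K_v) ≥ 1) = μ[1 − e^{−λ|K_v|/n}])] -/
theorem sum_wt_gind (hsymm : ∀ a b, edge a b = edge b a) (pE : E → ℝ) (h : ℝ) (a : W) :
    ∑ x, wt (Sum.elim pE (fun _ => h)) x * gind edge a x = greenProb edge pE h a := by
  classical
  have key := sum_wt_sumElim pE (fun _ : W => h)
    (fun y z => if HasGreen edge (Sum.elim y z) a then (1 : ℝ) else 0)
  have hx : ∀ x : E ⊕ W → Bool, gind edge a x
      = (if HasGreen edge (Sum.elim (fun e => x (Sum.inl e)) (fun u => x (Sum.inr u))) a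
          then (1 : ℝ) else 0) := by
    intro x
    have : Sum.elim (fun e => x (Sum.inl e)) (fun u => x (Sum.inr u)) = x := by
      ext i; cases i <;> rfl
    rw [this]; rfl
  simp_rw [hx, key, sum_ghost_hasGreen hsymm]
  rfl

/-- `E[g_v f] = E_ω[f · (1 − (1−h)^{|K_v|})]` (ghost field integrated out).
[cite: Hutchcroft2020, §3 proof of Prop 3.1 (eq. Covproof2, first equality)] -/
theorem sum_wt_gind_mul_fvol (hsymm : ∀ a b, edge a b = edge b a) (pE : E → ℝ) (h : ℝ) (n : ℕ)
    (v : W) :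
    ∑ x, wt (Sum.elim pE (fun _ => h)) x * (gind edge v x * fvol edge n v (fun e => x (Sum.inl e)))
      = ∑ y, wt pE y * (fvol edge n v y * (1 - (1 - h) ^ (cl edge y v).card)) := by
  classical
  have key := sum_wt_sumElim pE (fun _ : W => h)
    (fun y z => (if HasGreen edge (Sum.elim y z) v then (1 : ℝ) else 0) * fvol edge n v y)
  have hx : ∀ x : E ⊕ W → Bool, gind edge v x * fvol edge n v (fun e => x (Sum.inl e))
      = (if HasGreen edge (Sum.elim (fun e => x (Sum.inl e)) (fun u => x (Sum.inr u))) v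
          then (1 : ℝ) else 0) * fvol edge n v (fun e => x (Sum.inl e)) := by
    intro x
    have : Sum.elim (fun e => x (Sum.inl e)) (fun u => x (Sum.inr u)) = x := by
      ext i; cases i <;> rfl
    rw [this]; rfl
  simp_rw [hx, key]
  refine Finset.sum_congr rfl fun y _ => ?_
  have : ∑ z : W → Bool, wt (fun _ => h) z * ((if HasGreen edge (Sum.elim y z) v then (1 : ℝ) else 0)
      * fvol edge n v y) = fvol edge n v y * ∑ z : W → Bool, wt (fun _ => h) z
        * (if HasGreen edge (Sum.elim y z) v then (1 : ℝ) else 0) := by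
    rw [Finset.mul_sum]; exact Finset.sum_congr rfl fun z _ => by ring
  rw [this, sum_ghost_hasGreen hsymm]

/-- Covariances of `±1`-versions: `Cov[2a−1, 2b−1] = 4 Cov[a, b]` on a probability cube.
[cite: Hutchcroft2020, §2.3 eq. (CoVr_Cov) (CoVr = 2 Cov for {0,1}-valued functions)] -/
theorem cov_two_mul_sub_one {ι : Type*} [Fintype ι] [DecidableEq ι] (p : ι → ℝ)
    (a b : (ι → Bool) → ℝ) :
    (∑ x, wt p x * ((2 * a x - 1) * (2 * b x - 1)))
      - (∑ x, wt p x * (2 * a x - 1)) * (∑ x, wt p x * (2 * b x - 1))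
      = 4 * ((∑ x, wt p x * (a x * b x)) - (∑ x, wt p x * a x) * (∑ x, wt p x * b x)) := by
  have h1 : ∑ x, wt p x * ((2 * a x - 1) * (2 * b x - 1))
      = 4 * ∑ x, wt p x * (a x * b x) - 2 * ∑ x, wt p x * a x - 2 * ∑ x, wt p x * b x
        + ∑ x, wt p x := by
    simp only [Finset.mul_sum, ← Finset.sum_sub_distrib, ← Finset.sum_add_distrib]
    exact Finset.sum_congr rfl fun x _ => by ring
  have h2 : ∑ x, wt p x * (2 * a x - 1) = 2 * ∑ x, wt p x * a x - ∑ x, wt p x := by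
    simp only [Finset.mul_sum, ← Finset.sum_sub_distrib]
    exact Finset.sum_congr rfl fun x _ => by ring
  have h3 : ∑ x, wt p x * (2 * b x - 1) = 2 * ∑ x, wt p x * b x - ∑ x, wt p x := by
    simp only [Finset.mul_sum, ← Finset.sum_sub_distrib]
    exact Finset.sum_congr rfl fun x _ => by ring
  rw [h1, h2, h3, sum_wt]
  ring

/-- Influence of an EDGE coordinate on `2f − 1`: `Inf_{inl e}[2f−1] = 4 p_e(1−p_e) P(e pivotal)`.
[cite: Hutchcroft2020, §2.3 Thm 2.2 / eq. (CoVr_Cov) (Cov_μ[f, ω(e)] for increasing f)] -/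
theorem infl_inl_fvol (pE : E → ℝ) (h : ℝ) (n : ℕ) (v : W) (e : E) :
    infl (Sum.elim pE (fun _ : W => h)) (Sum.inl e)
        (fun x => 2 * fvol edge n v (fun e' => x (Sum.inl e')) - 1)
      = 4 * (pE e * (1 - pE e)) * pivVol edge pE n v e := by
  rw [infl_eq]
  simp only [Sum.elim_inl]
  have hx : ∀ y : E ⊕ W → Bool,
      |(2 * fvol edge n v (fun e' => update y (Sum.inl e) true (Sum.inl e')) - 1)
        - (2 * fvol edge n v (fun e' => update y (Sum.inl e) false (Sum.inl e')) - 1)|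
      = 2 * (fvol edge n v (update (fun e' => y (Sum.inl e')) e true)
          - fvol edge n v (update (fun e' => y (Sum.inl e')) e false)) := by
    intro y
    rw [inl_update, inl_update]
    have hle := fvol_update_false_le (edge := edge) n v (fun e' => y (Sum.inl e')) e
    rw [abs_of_nonneg (by linarith)]
    ring
  simp_rw [hx]
  have key := sum_wt_sumElim_left pE (fun _ : W => h)
    (fun y => 2 * (fvol edge n v (update y e true) - fvol edge n v (update y e false)))
  rw [key]
  unfold pivVol
  rw [Finset.mul_sum, Finset.mul_sum]
  exact Finset.sum_congr rfl fun y _ => by ring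

/-- Influence of a GHOST coordinate on `2f − 1` vanishes (`f` does not read the ghost field).
[cite: Hutchcroft2020, §3 proof of Prop 3.1 (f(ω,η) is independent of η)] -/
theorem infl_inr_fvol (p : E ⊕ W → ℝ) (n : ℕ) (v : W) (u : W) :
    infl p (Sum.inr u) (fun x => 2 * fvol edge n v (fun e' => x (Sum.inl e')) - 1) = 0 := by
  unfold infl
  refine Finset.sum_eq_zero fun x _ => Finset.sum_eq_zero fun y _ => ?_
  have : (fun e' => update y (Sum.inr u) (x (Sum.inr u)) (Sum.inl e')) = fun e' => y (Sum.inl e') := by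
    ext e'; rw [update_of_ne Sum.inl_ne_inr]
  beta_reduce
  rw [this, sub_self, abs_zero, mul_zero]

open Classical in
/-- HUTCHCROFT'S VOLUME COVARIANCE INEQUALITY (Prop 3.1, product measure on a finite graph, ghost density
`h`): if `E[1 − (1−h)^{|K_a|}] ≤ M` for every vertex `a`, then
`((1 − (1−h)^n) − E[1 − (1−h)^{|K_v|}]) · P(|K_v| ≥ n) ≤ 2 M ∑_e p_e(1−p_e) P(e pivotal for {|K_v| ≥ n})`.
[cite: Hutchcroft2020, §3 Prop 3.1] -/
theorem volume_covariance_inequality (hsymm : ∀ a b, edge a b = edge b a)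
    (hends : ∀ e a b a' b', edge a b = some e → edge a' b' = some e → a' = a ∨ a' = b)
    (pE : E → ℝ) (hp0 : ∀ e, 0 ≤ pE e) (hp1 : ∀ e, pE e ≤ 1) {h : ℝ} (hh0 : 0 ≤ h) (hh1 : h ≤ 1)
    (n : ℕ) (v : W) {M : ℝ} (hM : ∀ a, greenProb edge pE h a ≤ M) :
    ((1 - (1 - h) ^ n) - greenProb edge pE h v) * (∑ y, wt pE y * fvol edge n v y)
      ≤ 2 * M * ∑ e, pE e * (1 - pE e) * pivVol edge pE n v e := by
  set p : E ⊕ W → ℝ := Sum.elim pE (fun _ => h) with hp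
  have h0 : ∀ i, 0 ≤ p i := by rintro (e | u) <;> simp [hp, hp0, hh0]
  have h1 : ∀ i, p i ≤ 1 := by rintro (e | u) <;> simp [hp, hp1, hh1]
  set G : (E ⊕ W → Bool) → ℝ := fun x => 2 * fvol edge n v (fun e' => x (Sum.inl e')) - 1 with hG
  -- OSSS for the ghost-exploration strategy
  have osss := osss_cov_strategy p h0 h1 (strategy_legal edge) (label edge v) (abs_gpm_le edge v)
    (fun σ x hc hh => label_eq_of_halt v σ x hc hh) G
  -- left side = 4 Cov[g, f]
  have hlhs : (∑ y, wt p y * (gpm edge v y * G y)) - (∑ y, wt p y * gpm edge v y) * (∑ y, wt p y * G y)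
      = 4 * ((∑ x, wt p x * (gind edge v x * fvol edge n v (fun e => x (Sum.inl e))))
        - (∑ x, wt p x * gind edge v x) * (∑ x, wt p x * fvol edge n v (fun e => x (Sum.inl e)))) := by
    simp only [gpm_eq, hG]
    exact cov_two_mul_sub_one p _ _
  rw [hlhs, sum_wt_gind_mul_fvol hsymm, sum_wt_gind hsymm,
    sum_wt_sumElim_left pE (fun _ : W => h) (fvol edge n v)] at osss
  -- a priori bounds
  have hM0 : 0 ≤ M := by
    refine le_trans ?_ (hM v)
    unfold greenProb
    refine Finset.sum_nonneg fun y _ => mul_nonneg (wt_nonneg hp0 hp1 y) ?_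
    have : (1 - h) ^ (cl edge y v).card ≤ 1 := pow_le_one₀ (by linarith) (by linarith)
    linarith
  -- revealment of an edge coordinate is at most 2M
  have hrev : ∀ e, revealment p (strategy edge) (label edge v) (Sum.inl e) ≤ 2 * M := by
    intro e
    by_cases hex : ∃ a b, edge a b = some e
    · obtain ⟨a₀, b₀, hab⟩ := hex
      refine (revealment_edge_le p h0 h1 v e a₀ b₀
        (fun a b hab' => hends e a₀ b₀ a b hab hab')).trans ?_
      have e1 : ∑ x, wt p x * (if HasGreen edge x a₀ then (1 : ℝ) else 0) = greenProb edge pE h a₀ :=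
        sum_wt_gind hsymm pE h a₀
      have e2 : ∑ x, wt p x * (if HasGreen edge x b₀ then (1 : ℝ) else 0) = greenProb edge pE h b₀ :=
        sum_wt_gind hsymm pE h b₀
      rw [e1, e2]
      linarith [hM a₀, hM b₀]
    · push Not at hex
      exact (revealment_edge_le_zero p h0 h1 v e hex).trans (by linarith)
  -- right side: ghost coordinates contribute 0, edge coordinates `δ_e · 4 p_e(1-p_e) Piv_e`
  have hrhs : ∑ j, revealment p (strategy edge) (label edge v) j * infl p j G
      ≤ ∑ e, 2 * M * (4 * (pE e * (1 - pE e)) * pivVol edge pE n v e) := by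
    rw [Fintype.sum_sum_type]
    have hW : ∑ u : W, revealment p (strategy edge) (label edge v) (Sum.inr u)
        * infl p (Sum.inr u) G = 0 :=
      Finset.sum_eq_zero fun u _ => by rw [hG, infl_inr_fvol, mul_zero]
    rw [hW, add_zero]
    refine Finset.sum_le_sum fun e _ => ?_
    rw [← infl_inl_fvol pE h n v e, ← hp]
    exact mul_le_mul_of_nonneg_right (hrev e) (infl_nonneg h0 h1 _ _)
  have hfin := osss.trans hrhs
  have hsum : ∑ e, 2 * M * (4 * (pE e * (1 - pE e)) * pivVol edge pE n v e)
      = 4 * (2 * M * ∑ e, pE e * (1 - pE e) * pivVol edge pE n v e) := by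
    rw [Finset.mul_sum, Finset.mul_sum]; exact Finset.sum_congr rfl fun e _ => by ring
  rw [hsum] at hfin
  -- lower bound on E[g f]: on {f = 1} the cluster has ≥ n vertices
  have hlow : (1 - (1 - h) ^ n) * ∑ y, wt pE y * fvol edge n v y
      ≤ ∑ y, wt pE y * (fvol edge n v y * (1 - (1 - h) ^ (cl edge y v).card)) := by
    rw [Finset.mul_sum]
    refine Finset.sum_le_sum fun y _ => ?_
    have hw := wt_nonneg hp0 hp1 y
    by_cases hf : n ≤ (cl edge y v).card
    · have hpow : (1 - h) ^ (cl edge y v).card ≤ (1 - h) ^ n :=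
        pow_le_pow_of_le_one (by linarith) (by linarith) hf
      have hf1 : fvol edge n v y = 1 := by unfold fvol; rw [if_pos hf]
      rw [hf1]
      nlinarith
    · have hf0 : fvol edge n v y = 0 := by unfold fvol; rw [if_neg hf]
      rw [hf0]
      simp
  linarith

end GhostExploration

end Literature.Probability.Percolation
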